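/-
Copyright (c) 2026 the pub-hodgecm-mathlib formalisation cell (harness21).  Prover seat hodgecm-mathlib-LH4-p06 (g9), req620 Track A «(D-RAM) FOUR-FRAME» squad
F0∕P3c∕LH4; the (β₂) road (R-36) «PURE-CELL LEDGER», β₂ WORD #27 (a) of the sub-dealer LH4-p04 (g10): piece ‹D0› «AT δ = 0 THE DIAGONAL CELLS OF THE TWO LITERALS AGREE»,
file D0-1 = the `g = 0` twin of ★ K3 §Scalar ∕ ★ K4 of LH4-p19 (g2)'s diagonal-cell engine; helper lane on h413 = stmt-HodgeConjecture-24833 (count-neutral).  2026-09-05.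
-/
import Summits.HodgeConjecture.HodgeConjecture.Theorems.F0P3cDyRamDiagonalCellAffineLabel   -- ★ K4 (LH4-p19 (g2)): `v_fst_eq_of_fixed_coords`; brings ★ p861813 `refSkew_map_and_v`, ★ Lit `normSign_eq_of_near`, `normSign_mul_of_fixed`, the Eisenstein frame
import HarnessLib

/-!
# Crux `H413`, line LH4 «(D-RAM) FOUR-FRAME» — STAGE-1b, row (2), the (β₂) road (R-36), lane B, piece ‹D0› (β₂ WORD #24∕#27), file D0-1: «THE COORDINATES OF THE DIAGONAL
# CELL AT THE EIGENVALUE GAP δ = 0, AND ITS X-DIGIT» — ★ K3 `v_coords_scalar` and ★ K4 `exists_affineLabel_of_coords` with the roles of `Â, B̂` SWAPPED (`|B̂| = 1 ≥ |Â|`)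

Cell `hodgecm-mathlib` (D-0151), FLOOR 0, crux item H413 = `stmt-HodgeConjecture-24833`, route of record `HCCMUnconditional`; squad F0∕P3c∕LH4; lane
`--supports stmt-HodgeConjecture-24833 --as helper` (count-neutral; pays NO tier-0 row).  THEOREMS ONLY (no `def`, no instance, no notation, no `sorry`, default heartbeats);
★-only imports; states NO law; (β₂) stays a HYPOTHESIS.  Letters = ★ K3 §Scalar's (`K` valued, `ρ Θ` isometric involutions, `ρϖE = ϖE`, `|ϖE| = exp(−1)`, pivot `θ₀` with
`|θ₀| ≤ 1`, `|θ₀ − ρθ₀| = 1`, `|α − ρα| = 1`) and ★ K4's (sheet datum `IsRamifiedQuadraticDatum σ ϖ d t`, `d` even, complete, finite residue field; `t₊ = (ϖ − σϖ)((ϖσϖ)^{d∕2})⁻¹`,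
`ω = normSign σ`, `m* = mstarOfRecord d`).

WHY (β₂ WORD #24 (L3) ‹D0.letter.v1›; LH4-p15 (g2) 2026-09-05 00:31:41Z (c); this seat's SIG 01:04Z).  On the diagonal cell `(b, b)` of the live row `2b = m` the letter scalar of a
glued vertex is `s_Λ = Tr_ρ(μ∕D₀(Λ)) = T·(Â + B̂V)` (★ K3 `trace_scalar_eq_coords`, gap-free algebra), `μ̂ = μ∕(ϖEΘϖE)^b = Â + B̂θ₀`.  ★ K3 `v_coords_scalar` sizes the
coordinates at a POSITIVE gap `|μ − ρμ| = |ϖE|^{2b+2g}|α − ρα|`, `1 ≤ g`: `|Â| = 1`, `|B̂| = |ϖE|^{2g}`.  AT THE GAP `g = 0` (`jl = m`: `|μ − ρμ| = |μ| = |ϖE|^{2b}`) the roles swap: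
§1 `|μ̂| = 1`, `|B̂| = 1`, `|Â| ≤ 1`.  Consequently the affine read of ★ K4 changes shape (§2): the Eisenstein leading coefficients `α₁, γ₁` of `â∕t₊, b̂∕t₊` now have `|γ₁| = 1`,
`|α₁| ≤ 1`, and the affine form `α₁ + γ₁V` is a unit EXCEPT on ONE residue digit `V ≡ −α₁∕γ₁` — the X-DIGIT: off it, every `σ`-fixed `f` with `|T(â + b̂V) − f·t₊| ≤ |ϖ|^{m*}` has
`ω(f) = ω(T)·ω(α₁ + γ₁V)` exactly as in ★ K4; on it, the scalar `T(â + b̂V)` is NOT a unit (`|T(â + b̂V)| < 1 = |t₊|`), so the vertex's letter `thick_{m*}{s_Λ·N(a)}` (★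
`valueSet_endoGL_sub_one_glued_eq_scalar_normSet_of_diag`, gap-free) lies in `𝔭` — the vertices that LH4-p15's mechanism (c) puts off both shells.
* §1 `v_coords_scalar_of_gap_zero` — `|μ̂| = 1 ∧ |B̂| = 1 ∧ |Â| ≤ 1` at `g = 0`.
* §2 HEAD `exists_affineLabel_of_coords_of_gap_zero` — for `|â| ≤ 1`, `|b̂| = 1`: `∃ α₁ γ₁` `σ`-fixed, `|α₁| ≤ 1`, `|γ₁| = 1`, with (a) the affine read OFF the X-digit, (b) the
  non-unit scalar ON the X-digit, (c) the unit scalar OFF it.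
WHAT IS NOT CLAIMED: the per-vertex label∕shell read, the digit count, any cell law — sockets ‹Z-SH›∕‹Z-CNT› of the SIG; this file is gap-zero bookkeeping only.
HONEST LABEL.  Count-neutral; nothing printed is asserted; ‹D0› OPEN; `HC_CM` is proved only modulo the 7 printed citations (2 remaining named inputs: hLiu418 =
`stmt-HodgeConjecture-24832`, h413 = `stmt-HodgeConjecture-24833`) until rung 0 closes.
## References
* [Serre1979] J.-P. Serre, *Local Fields*, GTM 67 (1979): Ch. I §6 Prop. 18 (Eisenstein coordinates); Ch. III §6 Prop. 12; Ch. V §3 Cor. 3 pp. 85–87; Ch. XV §2 (norm classes).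
* [Jacobowitz1962] R. Jacobowitz, *Hermitian forms over local fields*, Amer. J. Math. 84 (1962): §4 (dual lattices, gluing).
* [Rogawski1990] J. D. Rogawski, *Automorphic Representations of Unitary Groups in Three Variables*, Ann. of Math. Stud. 123 (1990): §4.9 Prop. 4.9.1 (b) p. 55.
* [LanglandsShelstad1987] R. P. Langlands, D. Shelstad, *On the definition of transfer factors*, Math. Ann. 278 (1987): §1–§3 (κ-signs).
-/

set_option autoImplicit false

noncomputable section

namespace Summit.HodgeConjecture.HodgeConjecture.Cruxes.H413.F0P3cDyRamDiagonalCellCoordsDeltaZero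

open scoped Valued WithZero
open WithZero
open Literature.NumberTheory.Automorphic.UnitaryThreeFourFrame (IsRamifiedQuadraticDatum normSign)
open Literature.NumberTheory.LocalFields (exists_fixed_coords_of_map_ne v_fixed_add_fixed_mul_eq_max)
open Literature.NumberTheory.LocalFields.WildQuadraticDatum (even_log_v_of_fixed normSign_eq_of_near normSign_mul_of_fixed)
open Summit.HodgeConjecture.HodgeConjecture.Cruxes.H413.F0P3cDyRamFourFramePieces (mstarOfRecord)
open Summit.HodgeConjecture.HodgeConjecture.Cruxes.H413.F0P3cDyRamDiagonalCellCleanRegime (refSkew_map_and_v)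
open Summit.HodgeConjecture.HodgeConjecture.Cruxes.H413.F0P3cDyRamDiagonalCellAffineLabel (v_fst_eq_of_fixed_coords)

variable {K : Type} [Field K] [Valued K ℤᵐ⁰]

/-! ## §1 The sizes of the coordinates of the scalar at the gap `g = 0` -/

section Scalar

variable {ρ Θ : K →+* K} {α ϖE μ : K} {b : ℕ}

/-- **THE SIZES OF THE COORDINATES AT `g = 0`.**  `Θ` isometric, `ρϖE = ϖE`, `ΘρΘ = ρ` on `ϖE`, `|θ₀| ≤ 1`, `|θ₀ − ρθ₀| = 1`, `|α − ρα| = 1`; the (R-sp) depth `|μ| = |ϖE|^{2b}`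
and the gap ZERO `|μ − ρμ| = |ϖE|^{2b}·|α − ρα|`: with `μ̂ = μ∕(ϖEΘϖE)^b`, `B̂ = (μ̂ − ρμ̂)∕(θ₀ − ρθ₀)`, `Â = μ̂ − B̂θ₀` one has `|μ̂| = 1`, `|B̂| = 1`, `|Â| ≤ 1` (★ K3
`v_coords_scalar` is the case `1 ≤ g`: `|B̂| = |ϖE|^{2g} < 1 = |Â|`). [cite: Serre1979, Ch. III §6 Prop. 12] [cite: Jacobowitz1962, §4] -/
theorem v_coords_scalar_of_gap_zero (hΘρ : ∀ x, Θ (ρ x) = ρ (Θ x)) (hvΘ : ∀ x, Valued.v (Θ x) = Valued.v x)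
    (hρϖ : ρ ϖE = ϖE) (hϖE : Valued.v ϖE = exp (-1 : ℤ)) {θ₀ : K} (hθ1 : Valued.v θ₀ ≤ 1) (hθρ : Valued.v (θ₀ - ρ θ₀) = 1)
    (hαρ1 : Valued.v (α - ρ α) = 1) (hm : Valued.v μ = Valued.v ϖE ^ (2 * b))
    (hjl : Valued.v (μ - ρ μ) = Valued.v (ϖE ^ (2 * b) * (α - ρ α))) :
    Valued.v (μ / (ϖE * Θ ϖE) ^ b) = 1 ∧ Valued.v ((μ / (ϖE * Θ ϖE) ^ b - ρ (μ / (ϖE * Θ ϖE) ^ b)) / (θ₀ - ρ θ₀)) = 1 ∧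
      Valued.v (μ / (ϖE * Θ ϖE) ^ b - (μ / (ϖE * Θ ϖE) ^ b - ρ (μ / (ϖE * Θ ϖE) ^ b)) / (θ₀ - ρ θ₀) * θ₀) ≤ 1 := by
  have hvϖ0 : Valued.v ϖE ≠ 0 := by rw [hϖE]; exact exp_ne_zero
  have hϖ0 : ϖE ≠ 0 := fun h0 => by rw [h0, map_zero] at hvϖ0; exact hvϖ0 rfl
  have hPv : Valued.v ((ϖE * Θ ϖE) ^ b) = Valued.v ϖE ^ (2 * b) := by
    rw [Valuation.map_pow, Valuation.map_mul, hvΘ, ← pow_two, ← pow_mul, mul_comm]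
  have hρP : ρ ((ϖE * Θ ϖE) ^ b) = (ϖE * Θ ϖE) ^ b := by rw [map_pow, map_mul, hρϖ, ← hΘρ, hρϖ]
  have hmuh : Valued.v (μ / (ϖE * Θ ϖE) ^ b) = 1 := by rw [map_div₀, hm, hPv, div_self (pow_ne_zero _ hvϖ0)]
  have hBh : Valued.v ((μ / (ϖE * Θ ϖE) ^ b - ρ (μ / (ϖE * Θ ϖE) ^ b)) / (θ₀ - ρ θ₀)) = 1 := by
    have e : μ / (ϖE * Θ ϖE) ^ b - ρ (μ / (ϖE * Θ ϖE) ^ b) = (μ - ρ μ) / (ϖE * Θ ϖE) ^ b := by rw [map_div₀, hρP, sub_div]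
    rw [map_div₀, hθρ, div_one, e, map_div₀, hjl, Valuation.map_mul, hαρ1, mul_one, Valuation.map_pow, hPv, div_self (pow_ne_zero _ hvϖ0)]
  refine ⟨hmuh, hBh, ?_⟩
  refine (Valuation.map_sub _ _ _).trans (max_le (le_of_eq hmuh) ?_)
  rw [Valuation.map_mul, hBh, one_mul]; exact hθ1

end Scalar

/-! ## §2 HEAD — the affine letters at `g = 0`: the read off the X-digit, the non-unit scalar on it -/

section Affine

variable {σ : K →+* K} {ϖ : K} {d t : ℕ}

/-- **HEAD — «AT `g = 0` THE AFFINE FORM `α₁ + γ₁V` HAS UNIT SLOPE; OFF ITS ZERO DIGIT THE LABEL IS THE AFFINE SIGN, ON IT THE SCALAR DROPS».**  At a complete sheet datum with finite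
residue field and `d` EVEN, for `â, b̂` with `|â| ≤ 1`, `|b̂| = 1` there are `σ`-FIXED `α₁, γ₁` with `|α₁| ≤ 1`, `|γ₁| = 1` (leading Eisenstein coefficients of `â∕t₊`, `b̂∕t₊`) such that
for every `σ`-fixed unit `T` and `σ`-fixed integer `V`: (a) if `|α₁ + γ₁V| = 1` then every `σ`-fixed `f` with `|T(â + b̂V) − f·t₊| ≤ |ϖ|^{m*}` has `ω(f) = ω(T)·ω(α₁ + γ₁V)` (★ K4's
read, verbatim once `α₁ + γ₁V` is a unit); (b) if `|α₁ + γ₁V| < 1` then `|T(â + b̂V)| < 1` (the X-digit: ★ `v_fixed_add_fixed_mul_eq_max`, both Eisenstein tails have odd exponent);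
(c) if `|α₁ + γ₁V| = 1` then `|T(â + b̂V)| = 1` (any unit `T`, integer `V`).
[cite: Serre1979, Ch. I §6 Prop. 18] [cite: Serre1979, Ch. V §3 Cor. 3 pp. 85–87] [cite: Serre1979, Ch. XV §2] [cite: LanglandsShelstad1987, §1–§3] -/
theorem exists_affineLabel_of_coords_of_gap_zero [CompleteSpace K] [Finite 𝓀[K]] (hD : IsRamifiedQuadraticDatum σ ϖ d t) (hd2 : d % 2 = 0)
    {â bh : K} (hâ : Valued.v â ≤ 1) (hbh : Valued.v bh = 1) :
    ∃ α₁ γ₁ : K, σ α₁ = α₁ ∧ Valued.v α₁ ≤ 1 ∧ σ γ₁ = γ₁ ∧ Valued.v γ₁ = 1 ∧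
      (∀ (T V f : K), σ T = T → Valued.v T = 1 → σ V = V → Valued.v V ≤ 1 → σ f = f → Valued.v (α₁ + γ₁ * V) = 1 →
        Valued.v (T * (â + bh * V) - f * ((ϖ - σ ϖ) * ((ϖ * σ ϖ) ^ ((d - d % 2) / 2))⁻¹)) ≤ Valued.v ϖ ^ mstarOfRecord d →
        normSign σ f = normSign σ T * normSign σ (α₁ + γ₁ * V)) ∧
      (∀ (T V : K), σ T = T → Valued.v T = 1 → σ V = V → Valued.v V ≤ 1 → Valued.v (α₁ + γ₁ * V) < 1 →
        Valued.v (T * (â + bh * V)) < 1) ∧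
      (∀ (T V : K), Valued.v T = 1 → Valued.v V ≤ 1 → Valued.v (α₁ + γ₁ * V) = 1 → Valued.v (T * (â + bh * V)) = 1) := by
  obtain ⟨hσt, hvt⟩ := refSkew_map_and_v hD hd2
  obtain ⟨hσσ, hvσ, hϖ, hfix, hdd, hd1, ht⟩ := hD
  have hD' : IsRamifiedQuadraticDatum σ ϖ d t := ⟨hσσ, hvσ, hϖ, hfix, hdd, hd1, ht⟩
  have hfix' : ∀ c : K, σ c = c → c ≠ 0 → Even (log (Valued.v c)) := fun c hc hc0 => even_log_v_of_fixed hfix c hc hc0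
  have hvϖ0 : Valued.v ϖ ≠ 0 := by rw [hϖ]; exact exp_ne_zero
  have hϖσ : σ ϖ ≠ ϖ := fun h => by
    have : Valued.v (ϖ - σ ϖ) = 0 := by rw [h, sub_self, map_zero]
    rw [hdd] at this; exact pow_ne_zero _ hvϖ0 this
  set tp : K := (ϖ - σ ϖ) * ((ϖ * σ ϖ) ^ ((d - d % 2) / 2))⁻¹ with htp
  have htp0 : tp ≠ 0 := fun h0 => by rw [h0, map_zero] at hvt; exact zero_ne_one hvt
  -- Eisenstein coordinates of `â/t₊` and `b̂/t₊`
  obtain ⟨α₁, y₁, hα₁, hy₁, hα⟩ := exists_fixed_coords_of_map_ne hσσ hϖσ (â / tp)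
  obtain ⟨γ₁, y₂, hγ₁, hy₂, hγ⟩ := exists_fixed_coords_of_map_ne hσσ hϖσ (bh / tp)
  -- sizes: `|α₁| ≤ |â| ≤ 1`, `|y₁ϖ| ≤ 1`, `|γ₁| = 1`, `|y₂ϖ| ≤ 1` (★ `v_fixed_add_fixed_mul_eq_max`), and the tails have ODD exponent, hence `< 1`
  have hmaxa : Valued.v (â / tp) = max (Valued.v α₁) (Valued.v y₁ * exp (-1 : ℤ)) := by rw [hα]; exact v_fixed_add_fixed_mul_eq_max hfix' hϖ hα₁ hy₁
  have hmaxb : Valued.v (bh / tp) = max (Valued.v γ₁) (Valued.v y₂ * exp (-1 : ℤ)) := by rw [hγ]; exact v_fixed_add_fixed_mul_eq_max hfix' hϖ hγ₁ hy₂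
  have hâ' : Valued.v (â / tp) ≤ 1 := by rw [map_div₀, hvt, div_one]; exact hâ
  have hbh' : Valued.v (bh / tp) = 1 := by rw [map_div₀, hvt, div_one]; exact hbh
  have hα1 : Valued.v α₁ ≤ 1 := (le_max_left _ _).trans (hmaxa.symm.le.trans hâ')
  have hγ1 : Valued.v γ₁ = 1 := by
    have h := v_fst_eq_of_fixed_coords hD' hγ₁ hy₂ (n := 0) (by rw [← hγ, hbh']; norm_num)
    rw [h]; norm_num
  have htail : ∀ y : K, σ y = y → Valued.v y * exp (-1 : ℤ) ≤ 1 → Valued.v (y * ϖ) < 1 := by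
    intro y hy hle
    rw [Valuation.map_mul, hϖ]
    refine lt_of_le_of_ne hle fun h1 => ?_
    rcases eq_or_ne y 0 with rfl | hy0
    · rw [map_zero, zero_mul] at h1; exact zero_ne_one h1
    · obtain ⟨k, hk⟩ := hfix y hy hy0
      rw [hk, ← exp_add, ← exp_zero] at h1
      have := exp_injective h1
      omega
  have hy₁lt : Valued.v (y₁ * ϖ) < 1 := htail y₁ hy₁ ((le_max_right _ _).trans (hmaxa.symm.le.trans hâ'))
  have hy₂lt : Valued.v (y₂ * ϖ) < 1 := htail y₂ hy₂ ((le_max_right _ _).trans (hmaxb.symm.le.trans hbh'.le))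
  -- the decomposition `T(â + b̂V)/t₊ = f₀ + Y·ϖ`
  have hdec : ∀ T V : K, T * (â + bh * V) / tp = T * (α₁ + γ₁ * V) + T * (y₁ + y₂ * V) * ϖ := by
    intro T V
    have e1 : â = (α₁ + y₁ * ϖ) * tp := by rw [← hα, div_mul_cancel₀ â htp0]
    have e2 : bh = (γ₁ + y₂ * ϖ) * tp := by rw [← hγ, div_mul_cancel₀ bh htp0]
    rw [e1, e2]; field_simp; ring
  have hYϖ : ∀ T V : K, Valued.v T = 1 → Valued.v V ≤ 1 → Valued.v (T * (y₁ + y₂ * V) * ϖ) < 1 := by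
    intro T V hT1 hV1
    rw [mul_assoc, Valuation.map_mul, hT1, one_mul, add_mul, mul_assoc, mul_comm V ϖ, ← mul_assoc]
    refine lt_of_le_of_lt (Valuation.map_add _ _ _) (max_lt hy₁lt ?_)
    rw [Valuation.map_mul]
    calc Valued.v (y₂ * ϖ) * Valued.v V ≤ Valued.v (y₂ * ϖ) * 1 := by gcongr
      _ < 1 := by rw [mul_one]; exact hy₂lt
  refine ⟨α₁, γ₁, hα₁, hα1, hγ₁, hγ1, fun T V f hσT hT1 hσV hV1 hσf hunit hsf => ?_, fun T V _ hT1 _ hV1 hX => ?_, fun T V hT1 hV1 hunit => ?_⟩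
  · -- (a) the read off the X-digit: ★ K4's proof with `|f₀| = 1` from `hunit`
    have hT0 : T ≠ 0 := fun h0 => by rw [h0, map_zero] at hT1; exact zero_ne_one hT1
    set f₀ : K := T * (α₁ + γ₁ * V) with hf₀
    set Y : K := T * (y₁ + y₂ * V) with hY
    have hσf₀ : σ f₀ = f₀ := by rw [hf₀, map_mul, map_add, map_mul, hσT, hα₁, hγ₁, hσV]
    have hσY : σ Y = Y := by rw [hY, map_mul, map_add, map_mul, hσT, hy₁, hy₂, hσV]
    have hf₀1 : Valued.v f₀ = 1 := by rw [hf₀, Valuation.map_mul, hT1, one_mul, hunit]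
    have hnear : Valued.v (f₀ - f) ≤ Valued.v ϖ ^ mstarOfRecord d := by
      have h1 : Valued.v (T * (â + bh * V) / tp - f) ≤ Valued.v ϖ ^ mstarOfRecord d := by
        have e : T * (â + bh * V) / tp - f = (T * (â + bh * V) - f * tp) / tp := by field_simp
        rw [e, map_div₀, hvt, div_one]; exact hsf
      rw [hdec T V] at h1
      have e2 : f₀ + Y * ϖ - f = (f₀ - f) + Y * ϖ := by ring
      rw [e2, v_fixed_add_fixed_mul_eq_max hfix' hϖ (by rw [map_sub, hσf₀, hσf]) hσY] at h1
      exact (le_max_left _ _).trans h1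
    rw [normSign_eq_of_near hD' hσf₀ hσf hf₀1 (n := mstarOfRecord d) (by simp only [mstarOfRecord]; omega) hnear, hf₀]
    have hαV0 : α₁ + γ₁ * V ≠ 0 := fun h0 => by rw [h0, map_zero] at hunit; exact zero_ne_one hunit
    exact normSign_mul_of_fixed hD' hσT (by rw [map_add, map_mul, hα₁, hγ₁, hσV]) hT0 hαV0
  · -- (b) the X-digit: both summands of `T(â + b̂V)/t₊ = f₀ + Yϖ` are `< 1`
    have h1 : Valued.v (T * (â + bh * V) / tp) < 1 := by
      rw [hdec T V]
      refine lt_of_le_of_lt (Valuation.map_add _ _ _) (max_lt ?_ (hYϖ T V hT1 hV1))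
      rw [Valuation.map_mul, hT1, one_mul]; exact hX
    rwa [map_div₀, hvt, div_one] at h1
  · -- (c) off the X-digit the scalar is a unit: the affine part dominates the tail
    have hlt : Valued.v (T * (y₁ + y₂ * V) * ϖ) < Valued.v (T * (α₁ + γ₁ * V)) := by
      rw [Valuation.map_mul _ T, hT1, one_mul, hunit]; exact hYϖ T V hT1 hV1
    have h1 : Valued.v (T * (â + bh * V) / tp) = 1 := by
      rw [hdec T V, Valuation.map_add_eq_of_lt_left _ hlt, Valuation.map_mul, hT1, one_mul, hunit]
    rwa [map_div₀, hvt, div_one] at h1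

end Affine

end Summit.HodgeConjecture.HodgeConjecture.Cruxes.H413.F0P3cDyRamDiagonalCellCoordsDeltaZero

end
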